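import Summits.PneNP.PneNP.Theorems.ReslinSizeFromWidthPCDegreeFPHP
import Literature.Computability.MetaComplexity.FunctionalPigeonholeDegreeProof
import HarnessLib

/-!
# PneNP / ReslinSizeFromWidth — the PC rail's second PROVED input: graph functional pigeonhole principles (unconditional)

Helper file for the INPUT side of crux `ResLinSizeFromWidth` (stmt-PneNP-18932).
`ReslinSizeFromWidthPCDegreeFPHP.lean` fed Mikša–Nordström's degree lower bound for `FPHP_G`
(CCC 2015, Thm 4.9) into the PC rail as a NAMED FACT `hMN : MiksaNordstrom2015_PC_FPHP_degree`;
that fact is now DISCHARGED in the tree (`Literature/…/FunctionalPigeonholeDegreeProof.lean`: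
`MiksaNordstrom2015_PC_FPHP_degree_holds`, a kernel-checked proof through MN15's generalised
Alekhnovich–Razborov method, `MiksaNordstrom.not_refutableInDegree`).  This file records the
UNCONDITIONAL corollaries: for `N : Fin m → Finset (Fin n)` a bipartite `(s, δ)`-boundary expander
(`s ≥ 1`, `δ > 0`) with left degrees `≤ d` (`d ≥ 1`) and an integer `k ≤ δs/(2d)`,

* `¬ PC.RefutableInDegree (cnfPolys (ZMod 2) (FPHP.fphpCNF N)) k` (`not_refutableInDegree_fphpCNF'`);
* `max d 2 ≤ k` ⇒ every Res(⊕) refutation (semantic weakening) of `FPHP_G` has a line of rank `≥ k`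
  (`resLinWidth_fphpCNF'`, `le_minResLinWidth_fphpCNF'`);
* `max d 2 < k` ⇒ clause space `≥ k + 1 - max d 2` (`clauseSpace_fphpCNF'`, GOR Thm 11 shape),
  tree-like size `≥ 2^(k - max d 2 - 1)` (`treeLike_length_fphpCNF'`; Efremenko–Garlík–Itsykson 2024
  §1.1.1's example, now a theorem of the tree), and the quadratic dag-like law
  (`quadratic_length_fphpCNF'`).

Not here: explicit families of bipartite boundary expanders; GOR Thm 11's restriction step from
`FPHP^{n+1}_n`.

References: M. Mikša, J. Nordström, CCC 2015, Thm 4.9; S. Gryaznov, S. Ovcharov, A. Riazanov,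
ACM ToCT (2024), Thm 10/11; K. Efremenko, M. Garlík, D. Itsykson, STOC 2024, §1.1.1.
-/

noncomputable section

namespace Summit.PneNP.PneNP.Theorems

-- `Summit.PneNP.PneNP` repeats a path component by design (summit = sub-problem); silence the linter.
set_option linter.dupNamespace false

namespace ResLinPC

open Literature.Computability.Complexity Literature.Computability.MetaComplexity
open Summit.PneNP.PneNP.Theorems.PolyCalc

variable {m n : ℕ} (N : Fin m → Finset (Fin n)) {s δ : ℝ} {d k : ℕ}

/-- **MN15 Thm 4.9 over `𝔽₂`, unconditionally**: the clause polynomials of `FPHP_G` have no PC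
refutation of degree `≤ k ≤ δs/(2d)`. [Mikša–Nordström 2015, Thm 4.9 — proved in
`FunctionalPigeonholeDegreeProof.lean`] -/
theorem not_refutableInDegree_fphpCNF' (hs : 1 ≤ s) (hδ : 0 < δ) (hd : 1 ≤ d)
    (hdeg : ∀ u, (N u).card ≤ d) (hG : IsBoundaryExpander (FPHP.holeScope N) s δ)
    (hk : (k : ℝ) ≤ δ * s / (2 * d)) :
    ¬ PC.RefutableInDegree (cnfPolys (ZMod 2) (FPHP.fphpCNF N)) k :=
  not_refutableInDegree_fphpCNF N MiksaNordstrom2015_PC_FPHP_degree_holds hs hδ hd hdeg hG hk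

/-- **Res(⊕) rank of graph functional pigeonhole principles, unconditionally**:
`max d 2 ≤ k ≤ δs/(2d)` ⇒ every Res(⊕) refutation of `FPHP_G` contains a line of rank `≥ k`.
[Gryaznov–Ovcharov–Riazanov 2024, §4.1; Mikša–Nordström 2015, Thm 4.9] -/
theorem resLinWidth_fphpCNF' (hs : 1 ≤ s) (hδ : 0 < δ) (hd : 1 ≤ d)
    (hdeg : ∀ u, (N u).card ≤ d) (hG : IsBoundaryExpander (FPHP.holeScope N) s δ)
    (htk : max d 2 ≤ k) (hk : (k : ℝ) ≤ δ * s / (2 * d)) {π : List ResLinLine}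
    (hπ : IsResLinRefutation (FPHP.fphpCNF N) π) : k ≤ resLinWidth π :=
  resLinWidth_fphpCNF N MiksaNordstrom2015_PC_FPHP_degree_holds hs hδ hd hdeg hG htk hk hπ

/-- The same for the minimal refutation width (`ℕ∞`), unconditionally.
[Gryaznov–Ovcharov–Riazanov 2024, §4.1; Mikša–Nordström 2015, Thm 4.9] -/
theorem le_minResLinWidth_fphpCNF' (hs : 1 ≤ s) (hδ : 0 < δ) (hd : 1 ≤ d)
    (hdeg : ∀ u, (N u).card ≤ d) (hG : IsBoundaryExpander (FPHP.holeScope N) s δ)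
    (htk : max d 2 ≤ k) (hk : (k : ℝ) ≤ δ * s / (2 * d)) :
    (k : ℕ∞) ≤ minResLinWidth (FPHP.fphpCNF N) :=
  le_minResLinWidth_fphpCNF N MiksaNordstrom2015_PC_FPHP_degree_holds hs hδ hd hdeg hG htk hk

/-- **Res(⊕) clause space of graph functional pigeonhole principles, unconditionally**:
`max d 2 < k ≤ δs/(2d)` ⇒ clause space `≥ k + 1 - max d 2`. [Gryaznov–Ovcharov–Riazanov 2024,
Thm 11 (shape); Mikša–Nordström 2015, Thm 4.9] -/
theorem clauseSpace_fphpCNF' (hs : 1 ≤ s) (hδ : 0 < δ) (hd : 1 ≤ d)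
    (hdeg : ∀ u, (N u).card ≤ d) (hG : IsBoundaryExpander (FPHP.holeScope N) s δ)
    (htk : max d 2 + 1 ≤ k) (hk : (k : ℝ) ≤ δ * s / (2 * d)) {ϖ : List (Finset LinClause)}
    (hϖ : IsResLinSpaceRefutation (FPHP.fphpCNF N) ϖ) : k + 1 - max d 2 ≤ resLinClauseSpace ϖ :=
  clauseSpace_fphpCNF N MiksaNordstrom2015_PC_FPHP_degree_holds hs hδ hd hdeg hG htk hk hϖ

/-- **Tree-like Res(⊕) size of graph functional pigeonhole principles, unconditionally**: at least
`2^(k - max d 2 - 1)` lines. [Efremenko–Garlík–Itsykson 2024, §1.1.1; Mikša–Nordström 2015, Thm 4.9] -/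
theorem treeLike_length_fphpCNF' (hs : 1 ≤ s) (hδ : 0 < δ) (hd : 1 ≤ d)
    (hdeg : ∀ u, (N u).card ≤ d) (hG : IsBoundaryExpander (FPHP.holeScope N) s δ)
    (htk : max d 2 ≤ k) (hk : (k : ℝ) ≤ δ * s / (2 * d)) {π : List ResLinLine}
    (hπ : IsResLinRefutation (FPHP.fphpCNF N) π)
    (htree : ∀ i : ℕ, (π.map fun l => l.premises.count i).sum ≤ 1) :
    2 ^ (k - max d 2 - 1) ≤ π.length :=
  treeLike_length_fphpCNF N MiksaNordstrom2015_PC_FPHP_degree_holds hs hδ hd hdeg hG htk hk hπ htree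

/-- **Dag-like Res(⊕) size of graph functional pigeonhole principles, quadratic law,
unconditionally.** [Mikša–Nordström 2015, Thm 4.9; the tree's quadratic law] -/
theorem quadratic_length_fphpCNF' (hs : 1 ≤ s) (hδ : 0 < δ) (hd : 1 ≤ d)
    (hdeg : ∀ u, (N u).card ≤ d) (hG : IsBoundaryExpander (FPHP.holeScope N) s δ)
    (htk : max d 2 + 1 ≤ k) (hk : (k : ℝ) ≤ δ * s / (2 * d)) {π : List ResLinLine}
    (hπ : IsResLinRefutation (FPHP.fphpCNF N) π) :
    2 + (k - 1) * k ≤ 2 * π.length + max d 2 * (max d 2 + 1) :=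
  quadratic_length_fphpCNF N MiksaNordstrom2015_PC_FPHP_degree_holds hs hδ hd hdeg hG htk hk hπ

end ResLinPC

end Summit.PneNP.PneNP.Theorems
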